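import Summits.FinalStateConjecture.FinalStateConjecture.Theses.HorizonTypeCascade
import Summits.FinalStateConjecture.FinalStateConjecture.Theorems.ZeroEnergyKerrOrBombStationaryLimitReductionKerrChartedOfExtension
import HarnessLib

/-!
# Birth skeleton (BC3) — crux `HorizonTypeCascade.KerrChartTransfer` (stmt-FinalStateConjecture-18556), line `birth`

Skeleton registrar planner-skel-stmt-FinalStateConjecture-18556-0, 2026-08-17 (route re-audit bin HONEST);
published as `Cruxes/KerrChartTransfer/Lines/birth.lean`. The crux is FIXED (route
`route-FinalStateConjecture-HorizonTypeCascade`, rank 3, decl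
`Summit.FinalStateConjecture.FinalStateConjecture.Theses.HorizonTypeCascade.KerrChartTransfer`) and is concluded
BY NAME by `KerrChartTransfer_of` (§3).

## What the crux says (read-back `kerrChartTransfer_iff`, `Iff.rfl`)

For a stationary final state decomposition `d : StationaryFinalStateDecomposition 𝓢 O 2` whose holes are
`I⁺`-regular vacuum with non-empty `𝓔⁺` and a non-degenerate Killing COLLAR on every horizon component
(H1 = `HoleRegular`), whose d.o.c.s are abstractly isometric to sub-extremal Kerr exteriors in the route's
`Diffeomorph` form (H2 = `DocIsometricToKerr`), read in immersive horizon-penetrating adapted charts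
(H3 = `ChartPenetrating`), with exhaustive charts (H4 = `ChartsExhaust`, radii `→ ∞`) and future-oriented chart
times (H5 = `ChartsFutureOriented`), there is a summit `FinalStateDecomposition 𝓢 O 2` with sub-extremal
parameters, the SAME charted region, honest-radii `HasExhaustiveCharts` and `IsFutureOriented`
(`SameRegionKerrDecomposition`).

## The cut — the route's own two-layer plan "KerrChartTransfer ⇐ KerrReadaptation → RebuildDecomposition",
## with the re-adaptation typed over the LANDED chart-identification vocabulary of the sibling frame
## (`SymplecticDualOfTheBomb.IsKerrCharted`, p101414; `isKerrCharted_of_chartedExtension`, p104678)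

The prelude itself names the gap this crux fills (`StationaryFinalStateDecomposition.lean`, module docstring
"What is NOT proved here (route business)"): from the ABSTRACT isometry `Φ : ⟨⟨M_ext⟩⟩ ≅ {r > r₊}` one must
(i) pass to a future-preserving, `T`-equivariant isometry using the isometry group of Kerr, and (ii) re-adapt
the late-time charts, which needs regularity of the transition up to `𝓗⁺` and a comparison of the two slab
families. Accordingly:

* S1 `stub_futureEquivariantKerrIsometry` (geometry of ONE hole; M/L) — H1, H2 ⇒ a FUTURE-NORMALISED
  `T`-EQUIVARIANT isometric embedding `Ψ` of the Kerr–Schild exterior `{r > r₊}` of a sub-extremal `(M, a)` onto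
  `⟨⟨M_ext⟩⟩`: `dΨ(∂_{t*}) = c T`, `c > 0`, `Ψ^* g = g_{M,a}` (Kerr–Schild form `Kerr.bilin`), `Ψ '' ext = doc`.
  Content: inverting the route's `Diffeomorph` at the tree's instances (`hasLeviCivita`, `kerrFacts`,
  `isOpen_chronological{Future,Past}_holds_of_boundaryless`), the Killing algebra of Kerr / Schwarzschild
  (`Ψ^* T = α ∂_{t*} + β ∂_φ (+ so(3))`; Literature facts `ONeill1995_kerrKillingFields`,
  `StephaniEtAl2003_schwarzschildKillingFields`), `β = 0` because `T` is timelike on the whole orbit `M_ext`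
  of an asymptotically flat END (no adapted-chart asymptotics are available in this crux — the end argument
  is intrinsic), and the sign of `α` fixed by the backwards isometry (`ONeill1995_kerrBackwardsIsometry`,
  consumer `exists_futureNormalised_kerrExterior` landed).
* S2 `stub_collarHorizonExtension` (geometry of ONE hole; L; the HARDEST honest stub) — H1 (the COLLAR:
  non-degenerate horizon Killing field on a neighbourhood of each component, `I⁺`-regularity) and H3
  (immersive chart covering `𝓔⁺`) ⇒ such a `Ψ` extends to a smooth injective infinitesimally `T`-equivariant
  map `Φ` of a horizon-PENETRATING Kerr–Schild region `{r > r₀}`, `r₋ < r₀ < r₊`, into `range A`, agreeing with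
  `Ψ` (hence isometric, d.o.c.-anchored) on the exterior: `C^∞` boundary regularity of the d.o.c. isometry at
  the future event horizon read in horizon-regular charts. This is the sibling obligation F3
  `KerrHorizonExtension` (Theorems/…KerrIsometryRigidityWave3Facts, "NONE-EXISTS in print as a theorem";
  ingredients Chruściel–Costa 2008 §4.1–4.3) in COLLAR dress instead of telescope/asymptotically-Cartesian
  dress — the crux's own "why it might fail" (time orientation of `Φ`; `C³` up to `𝓗⁺`).
* then the LANDED `isKerrCharted_of_chartedExtension` (p104678) turns `(A, Φ)` into the chart-level
  identification `IsKerrCharted (d.hole i) (d.adapted i)` (`Θ := A⁻¹ ∘ Φ`, smooth on `{r > r₀}`,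
  `Θ(x + s e₀) = Θ x + (c s) e₀`, `A.bilin`-isometric on the exterior, anchored) — §3, kernel-checked here;
* S3 `stub_sameRegionTransfer` (dynamics + causal bookkeeping of the DECOMPOSITION; L) — the crux with its
  abstract-isometry hypothesis H2 REPLACED by the chart-level identification `∀ i, IsKerrCharted (d.hole i)
  (d.adapted i)` (H1, H3, H4, H5 kept): re-chart `chart i ∘ Θᵢ`, move `C²` convergence through `Θᵢ` to growing
  truncated Kerr–Schild slabs (for FIXED radius only compactness of `{t* = 0, r₊ ≤ r ≤ R}` and `C³`-regularity of
  `Θᵢ` across `r = r₊` are used — no bounded tilt is available or claimed), push orientation through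
  (`kerrIdentificationFuture`, p135232, re-derived for the 10-clause form), and re-derive the SAME-`O`
  exhaustion clause and `d'.charted = d.charted`. This is node "RebuildDecomposition" of the route plan.

HONESTY NOTE (refuter birth attack, `Cruxes/KerrChartTransfer/BirthAttack.md`, 2026-08-17): the refuter
exhibits a PAPER counterexample to the crux in its own honest model (exact sub-extremal Kerr with a plunging
`T`-adapted collar chart): H3's penetration forces a late interior collar into `d.charted ⊆ O`, and no
exterior Kerr–Schild certified slab has those points in its causal past, so `HasExhaustiveCharts d'` over the
SAME `O` fails (class misstated; repairs C′₁ d.o.c.-charted region / C′₂ recut, both planner business). In THIS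
skeleton that objection lands ENTIRELY on S3 (its hypotheses hold in the refuter's model with `Θ = id`, its
conclusion is the crux's): S1 and S2 are untouched by it and are exactly what any restatement (C′₁/C′₂, or the
sibling recut currency `chartTransferT2_unfolded`) still needs. A disprover should therefore aim at S3 (same
missing tree facts as for the crux: `doc = {r > r₊}` / `I⁺`-regularity / interior peeling for
`Kerr.stationaryAFBlackHole`), a prover at S1/S2.

Composition `KerrChartTransfer_of : S1 → S2 → S3 → KerrChartTransfer` (§3, sorry-free): per hole, S1 gives
`(M, a, c, Ψ)`, S2 the charted extension `Φ`, the landed `isKerrCharted_of_chartedExtension` (with H3's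
immersivity) gives `IsKerrCharted`, and S3 rebuilds the decomposition. `lean check --json`: rc 0, sorries 3 =
the three `stub_*`; nothing else uses `sorry`.

Registered stub signatures are DEF-FREE (expanded over the route file's vocabulary, the Lorentz prelude and the
landed sibling definition `SymplecticDualOfTheBomb.IsKerrCharted`), so that stub proofs can land as
`Theorems/…` files; §0 gives named read-backs (`HoleRegular`, `DocIsometricToKerr`, `ChartPenetrating`,
`ChartsExhaust`, `ChartsFutureOriented`, `SameRegionKerrDecomposition`, `FutureKerrIsometryData`,
`ChartedKerrExtensionData`, `Sig.stub_*`), each tied to the registered text by `Iff.rfl`.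

## BC3 probes (seat folder `bc/Probe_<stub>_{crux,summit}.lean`; they import the route file + the landed sibling
## Defs module ONLY — not this skeleton — so no sorried theorem concluding the crux is in scope for `exact?`)

For each stub `S`: `example : S → KerrChartTransfer` and `example : S → FinalStateConjecture` by
`first | exact? | simpa | aesop` — all six FAIL (outputs quoted in `Lines/birth.md`). Informally: S1/S2 are
statements about ONE stationary hole (no decomposition, no dynamics); S3 needs the chart-level identification,
which nothing but S1+S2 produces.
-/

-- every `Summit.FinalStateConjecture.FinalStateConjecture.…` name repeats the summit = sub-problem segment (D-0017 layout)
set_option linter.dupNamespace false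

noncomputable section

open scoped Manifold ContDiff Topology
open Set Filter Literature.Geometry.Lorentzian

namespace Summit.FinalStateConjecture.FinalStateConjecture.Cruxes.KerrChartTransfer.Birth

open Summit.FinalStateConjecture.FinalStateConjecture.Theses.HorizonTypeCascade
open Summit.FinalStateConjecture.FinalStateConjecture.Theorems.SymplecticDualOfTheBomb
open Summit.FinalStateConjecture.FinalStateConjecture.Theorems.OneLockedExplosion

/-! ## §0 Read-backs of the crux's clauses and of the line's data (definitions; nothing asserted) -/

/-- H1 of the crux for one hole `𝓑`: `I⁺`-regular, vacuum, `𝓔⁺ ≠ ∅`, and every horizon COMPONENT carries a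
non-degenerate Killing collar (`K` Killing on an open `U ⊇` component, `[T, K] = 0`, `K ≠ 0` and tangent on
the component, `∇_K K = κ K`, `κ ≠ 0`) — verbatim the crux text with `d.hole i ↦ 𝓑`. -/
def HoleRegular (𝓑 : Literature.Geometry.Lorentzian.StationaryAFBlackHole.{0}) : Prop :=
  (∀ [𝓑.metric.HasLeviCivita], 𝓑.IsIPlusRegular ∧ 𝓑.metric.toPseudoRiemannianMetric.IsRicciFlat ∧ 𝓑.horizon.Nonempty ∧ (∀ p ∈ 𝓑.horizon, ∃ (U : Set 𝓑.carrier) (K : Π x : 𝓑.carrier, TangentSpace (𝓡 4) x) (κ : ℝ), IsOpen U ∧ connectedComponentIn 𝓑.horizon p ⊆ U ∧ ContMDiffOn (𝓡 4) ((𝓡 4).prod 𝓘(ℝ, Literature.Geometry.Lorentzian.E4)) ((⊤ : ℕ∞) : WithTop ℕ∞) (fun x ↦ (Bundle.TotalSpace.mk' Literature.Geometry.Lorentzian.E4 x (K x) : TangentBundle (𝓡 4) 𝓑.carrier)) U ∧ (∀ x ∈ U, ∀ v w : TangentSpace (𝓡 4) x, 𝓑.metric.val x (𝓑.metric.leviCivita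 K x v) w + 𝓑.metric.val x v (𝓑.metric.leviCivita K x w) = 0) ∧ (∀ x ∈ U, VectorField.mlieBracket (𝓡 4) 𝓑.killing K x = 0) ∧ (∀ q ∈ connectedComponentIn 𝓑.horizon p, K q ≠ 0) ∧ (∀ γ : ℝ → 𝓑.carrier, IsMIntegralCurve γ K → γ 0 ∈ connectedComponentIn 𝓑.horizon p → ∀ t, γ t ∈ 𝓑.horizon) ∧ κ ≠ 0 ∧ ∀ q ∈ connectedComponentIn 𝓑.horizon p, 𝓑.metric.leviCivita K q (K q) = κ • K q))

/-- H2 of the crux for one hole `𝓑`: the d.o.c. is isometric to a sub-extremal Kerr exterior, in the route's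
pointwise-unfolded `Diffeomorph` form (no `hres`) — verbatim with `d.hole i ↦ 𝓑`. -/
def DocIsometricToKerr (𝓑 : Literature.Geometry.Lorentzian.StationaryAFBlackHole.{0}) : Prop :=
  (∀ [𝓑.metric.HasLeviCivita] [Literature.Geometry.Lorentzian.Kerr.Facts] (hF : 𝓑.metric.isOpen_chronologicalFuture 𝓑.timeOrientation) (hP : 𝓑.metric.isOpen_chronologicalPast 𝓑.timeOrientation), (∃ (M a : ℝ) (_ : Literature.Geometry.Lorentzian.Kerr.IsSubextremal M a) (Φ : Diffeomorph (𝓡 4) 𝓘(ℝ, Literature.Geometry.Lorentzian.E4) (𝓑.docOpens hF hP) (Literature.Geometry.Lorentzian.Kerr.exterior M a) ((⊤ : ℕ∞) : WithTop ℕ∞)), ∀ (y : 𝓑.docOpens hF hP) (v w : EuclideanSpace ℝ (Fin 4)), (Literature.Geometry.Lorentzian.Kerr.smoothMetric M a (Literature.Geometry.Lorentzian.Kerr.rPlus M a)).val (Φ y) (mfderiv (𝓡 4) 𝓘(ℝ, Literature.Geometry.Lorentzian.E4) Φ y v) (mfderiv (𝓡 4) 𝓘(ℝ, Literature.Geometry.Lorentzian.E4)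 Φ y w) = 𝓑.metric.val y.1 v w))

/-- H3 of the crux for one adapted chart `A` of `𝓑`: immersive and horizon-penetrating — verbatim with
`d.adapted i ↦ A`, `d.hole i ↦ 𝓑`. -/
def ChartPenetrating {𝓑 : Literature.Geometry.Lorentzian.StationaryAFBlackHole.{0}} (A : 𝓑.AdaptedChart) : Prop :=
  ((∀ x, Function.Injective (mfderiv 𝓘(ℝ, Literature.Geometry.Lorentzian.E4) (𝓡 4) A.toFun x)) ∧ 𝓑.horizon ⊆ Set.range A.toFun)

section Decomposition

variable {𝓢 : Literature.Geometry.Lorentzian.Spacetime.{0} 4} {O : Set 𝓢.carrier}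

/-- H4 of the crux: exhaustive charts with radii `→ ∞` (verbatim). -/
def ChartsExhaust (d : Literature.Geometry.Lorentzian.StationaryFinalStateDecomposition 𝓢 O 2) : Prop :=
  (∃ R : Fin d.N → ℝ → ℝ, (∀ i, Filter.Tendsto (R i) Filter.atTop Filter.atTop) ∧ (∀ i, Filter.Tendsto (fun τ ↦ 𝓢.truncDeviationCk (d.background i) (d.toOver.chart i) 2 (R i τ) τ) Filter.atTop (nhds 0)) ∧ ∀ τ₁ : ℝ, d.toOver.τ₀ < τ₁ → O \ d.toOver.certifiedLate R τ₁ ⊆ 𝓢.metric.causalPast 𝓢.timeOrientation (d.toOver.certifiedSlab R τ₁))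

/-- H5 of the crux: orthochronous motions and future-oriented chart times (verbatim). -/
def ChartsFutureOriented (d : Literature.Geometry.Lorentzian.StationaryFinalStateDecomposition 𝓢 O 2) : Prop :=
  ((∀ i, Summit.FinalStateConjecture.IsOrthochronous (d.motion i).1) ∧ (∀ i (ρ : ℝ), ∀ᶠ τ in Filter.atTop, ∀ x ∈ (d.background i).truncTimeSlab ρ τ, ∀ v : Literature.Geometry.Lorentzian.E4, mfderiv 𝓘(ℝ, Literature.Geometry.Lorentzian.E4) (𝓡 4) (d.adapted i).toFun ⟨Literature.Geometry.Lorentzian.poincareInv (d.motion i).1 (d.motion i).2 x.1, x.2⟩ v = (d.hole i).timeOrientation.vectorField ((d.adapted i).toFun ⟨Literature.Geometry.Lorentzian.poincareInv (d.motion i).1 (d.motion i).2 x.1, x.2⟩) → 𝓢.timeOrientation.IsFutureDirected (mfderiv 𝓘(ℝ, Literature.Geometry.Lorentzian.E4) (𝓡 4) (d.toOver.chart i) x (((d.motion i).1 : Literature.Geometry.Lorentzian.E4 ≃L[ℝ] Literature.Geometry.Lorentzian.E4) v))) ∧ ∀ᶠ τ in Filter.atTop, ∀ x ∈ (Literature.Geometry.Lorentzian.Minkowski.backgroundOn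 d.toOver.flatDomain).timeSlab τ, 𝓢.timeOrientation.IsFutureDirected (mfderiv 𝓘(ℝ, Literature.Geometry.Lorentzian.E4) (𝓡 4) d.toOver.flatChart x (Literature.Geometry.Lorentzian.E4.basisVector 0)))

/-- The conclusion of the crux: a summit decomposition with sub-extremal parameters, the SAME charted region,
honest-radii exhaustive charts and future-oriented chart times (verbatim). -/
def SameRegionKerrDecomposition (d : Literature.Geometry.Lorentzian.StationaryFinalStateDecomposition 𝓢 O 2) : Prop :=
  ∃ d' : Literature.Geometry.Lorentzian.FinalStateDecomposition 𝓢 O 2, (∀ i, Literature.Geometry.Lorentzian.Kerr.IsSubextremal (d'.mass i) (d'.spin i)) ∧ d'.charted = d.charted ∧ Summit.FinalStateConjecture.HasExhaustiveCharts d' ∧ Summit.FinalStateConjecture.IsFutureOriented d'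

end Decomposition

/-- Read-back: the crux IS `H1 → H2 → H3 → H4 → H5 → conclusion` over the §0 names (definitional). -/
theorem kerrChartTransfer_iff :
    KerrChartTransfer ↔
      ∀ (𝓢 : Literature.Geometry.Lorentzian.Spacetime.{0} 4) (O : Set 𝓢.carrier) (d : Literature.Geometry.Lorentzian.StationaryFinalStateDecomposition 𝓢 O 2),
        (∀ i, HoleRegular (d.hole i)) → (∀ i, DocIsometricToKerr (d.hole i)) →
          (∀ i, ChartPenetrating (d.adapted i)) → ChartsExhaust d → ChartsFutureOriented d →
            SameRegionKerrDecomposition d :=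
  Iff.rfl

/-- **Future-normalised `T`-equivariant Kerr isometry data** (output of S1, input of S2): `(M, a)` sub-extremal,
`c > 0`, and a map `Ψ : E4 → 𝓑` (junk off the exterior) smooth and injective on the Kerr–Schild exterior
`{r > r₊}`, with `Ψ '' ext = ⟨⟨M_ext⟩⟩`, `dΨ_x(e₀) = c T(Ψ x)` and `g(dΨ v, dΨ w) = g_{M,a}(v, w)` (Kerr–Schild form)
on the exterior. -/
def FutureKerrIsometryData (𝓑 : Literature.Geometry.Lorentzian.StationaryAFBlackHole.{0}) (M a c : ℝ) (Ψ : Literature.Geometry.Lorentzian.E4 → 𝓑.carrier) : Prop :=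
  Literature.Geometry.Lorentzian.Kerr.IsSubextremal M a ∧ 0 < c ∧ ContMDiffOn 𝓘(ℝ, Literature.Geometry.Lorentzian.E4) (𝓡 4) ((⊤ : ℕ∞) : WithTop ℕ∞) Ψ (Literature.Geometry.Lorentzian.Kerr.exterior M a : Set Literature.Geometry.Lorentzian.E4) ∧ Set.InjOn Ψ (Literature.Geometry.Lorentzian.Kerr.exterior M a : Set Literature.Geometry.Lorentzian.E4) ∧ Ψ '' (Literature.Geometry.Lorentzian.Kerr.exterior M a : Set Literature.Geometry.Lorentzian.E4) = 𝓑.doc ∧ (∀ x ∈ (Literature.Geometry.Lorentzian.Kerr.exterior M a : Set Literature.Geometry.Lorentzian.E4), mfderiv 𝓘(ℝ, Literature.Geometry.Lorentzian.E4) (𝓡 4) Ψ x (Literature.Geometry.Lorentzian.E4.basisVector 0) = c • 𝓑.killing (Ψ x)) ∧ (∀ x ∈ (Literature.Geometry.Lorentzian.Kerr.exterior M a : Set Literature.Geometry.Lorentzian.E4), ∀ v w : Literature.Geometry.Lorentzian.E4, 𝓑.metric.val (Ψ x) (mfderiv 𝓘(ℝ, Literature.Geometry.Lorentzian.E4) (𝓡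 4) Ψ x v) (mfderiv 𝓘(ℝ, Literature.Geometry.Lorentzian.E4) (𝓡 4) Ψ x w) = Literature.Geometry.Lorentzian.Kerr.bilin M a x v w)

/-- **Charted horizon-penetrating extension data** (output of S2 = the hypotheses of the landed
`isKerrCharted_of_chartedExtension` after immersivity, plus agreement with `Ψ`): `r₋ < r₀ < r₊` and
`Φ : E4 → 𝓑` smooth and injective on `{r > r₀}`, valued in `range A`, infinitesimally `T`-equivariant there,
isometric and d.o.c.-anchored on the exterior, and equal to `Ψ` on the exterior. -/
def ChartedKerrExtensionData {𝓑 : Literature.Geometry.Lorentzian.StationaryAFBlackHole.{0}} (A : 𝓑.AdaptedChart) (M a c r₀ : ℝ)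
    (Ψ Φ : Literature.Geometry.Lorentzian.E4 → 𝓑.carrier) : Prop :=
  Literature.Geometry.Lorentzian.Kerr.rMinus M a < r₀ ∧ r₀ < Literature.Geometry.Lorentzian.Kerr.rPlus M a ∧ ContMDiffOn 𝓘(ℝ, Literature.Geometry.Lorentzian.E4) (𝓡 4) ((⊤ : ℕ∞) : WithTop ℕ∞) Φ (Literature.Geometry.Lorentzian.Kerr.region a r₀ : Set Literature.Geometry.Lorentzian.E4) ∧ Set.InjOn Φ (Literature.Geometry.Lorentzian.Kerr.region a r₀ : Set Literature.Geometry.Lorentzian.E4) ∧ Set.MapsTo Φ (Literature.Geometry.Lorentzian.Kerr.region a r₀ : Set Literature.Geometry.Lorentzian.E4) (Set.range A.toFun) ∧ (∀ x ∈ (Literature.Geometry.Lorentzian.Kerr.region a r₀ : Set Literature.Geometry.Lorentzian.E4), mfderiv 𝓘(ℝ, Literature.Geometry.Lorentzian.E4) (𝓡 4) Φ x (Literature.Geometry.Lorentzian.E4.basisVector 0) = c • 𝓑.killing (Φ x)) ∧ (∀ x ∈ (Literature.Geometry.Lorentzian.Kerr.exterior M a : Set Literature.Geometry.Lorentzian.E4),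 ∀ v w : Literature.Geometry.Lorentzian.E4, 𝓑.metric.val (Φ x) (mfderiv 𝓘(ℝ, Literature.Geometry.Lorentzian.E4) (𝓡 4) Φ x v) (mfderiv 𝓘(ℝ, Literature.Geometry.Lorentzian.E4) (𝓡 4) Φ x w) = Literature.Geometry.Lorentzian.Kerr.bilin M a x v w) ∧ Φ '' (Literature.Geometry.Lorentzian.Kerr.exterior M a : Set Literature.Geometry.Lorentzian.E4) = 𝓑.doc ∧ ∀ x ∈ (Literature.Geometry.Lorentzian.Kerr.exterior M a : Set Literature.Geometry.Lorentzian.E4), Φ x = Ψ x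

namespace Sig

/-- Statement of S1 over the §0 names. -/
def stub_futureEquivariantKerrIsometry : Prop :=
  ∀ (𝓑 : Literature.Geometry.Lorentzian.StationaryAFBlackHole.{0}), HoleRegular 𝓑 → DocIsometricToKerr 𝓑 →
    ∃ (M a c : ℝ) (Ψ : Literature.Geometry.Lorentzian.E4 → 𝓑.carrier), FutureKerrIsometryData 𝓑 M a c Ψ

/-- Statement of S2 over the §0 names. -/
def stub_collarHorizonExtension : Prop :=
  ∀ (𝓑 : Literature.Geometry.Lorentzian.StationaryAFBlackHole.{0}) (A : 𝓑.AdaptedChart) (M a c : ℝ) (Ψ : Literature.Geometry.Lorentzian.E4 → 𝓑.carrier),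
    HoleRegular 𝓑 → ChartPenetrating A →
    Literature.Geometry.Lorentzian.Kerr.IsSubextremal M a → 0 < c →
    ContMDiffOn 𝓘(ℝ, Literature.Geometry.Lorentzian.E4) (𝓡 4) ((⊤ : ℕ∞) : WithTop ℕ∞) Ψ (Literature.Geometry.Lorentzian.Kerr.exterior M a : Set Literature.Geometry.Lorentzian.E4) →
    Set.InjOn Ψ (Literature.Geometry.Lorentzian.Kerr.exterior M a : Set Literature.Geometry.Lorentzian.E4) →
    Ψ '' (Literature.Geometry.Lorentzian.Kerr.exterior M a : Set Literature.Geometry.Lorentzian.E4) = 𝓑.doc →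
    (∀ x ∈ (Literature.Geometry.Lorentzian.Kerr.exterior M a : Set Literature.Geometry.Lorentzian.E4), mfderiv 𝓘(ℝ, Literature.Geometry.Lorentzian.E4) (𝓡 4) Ψ x (Literature.Geometry.Lorentzian.E4.basisVector 0) = c • 𝓑.killing (Ψ x)) →
    (∀ x ∈ (Literature.Geometry.Lorentzian.Kerr.exterior M a : Set Literature.Geometry.Lorentzian.E4), ∀ v w : Literature.Geometry.Lorentzian.E4, 𝓑.metric.val (Ψ x) (mfderiv 𝓘(ℝ, Literature.Geometry.Lorentzian.E4) (𝓡 4) Ψ x v) (mfderiv 𝓘(ℝ, Literature.Geometry.Lorentzian.E4) (𝓡 4) Ψ x w) = Literature.Geometry.Lorentzian.Kerr.bilin M a x v w) →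
    ∃ (r₀ : ℝ) (Φ : Literature.Geometry.Lorentzian.E4 → 𝓑.carrier), ChartedKerrExtensionData A M a c r₀ Ψ Φ

/-- Statement of S3 over the §0 names. -/
def stub_sameRegionTransfer : Prop :=
  ∀ (𝓢 : Literature.Geometry.Lorentzian.Spacetime.{0} 4) (O : Set 𝓢.carrier) (d : Literature.Geometry.Lorentzian.StationaryFinalStateDecomposition 𝓢 O 2),
    (∀ i, HoleRegular (d.hole i)) → (∀ i, Summit.FinalStateConjecture.FinalStateConjecture.Theorems.SymplecticDualOfTheBomb.IsKerrCharted (d.hole i) (d.adapted i)) →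
      (∀ i, ChartPenetrating (d.adapted i)) → ChartsExhaust d → ChartsFutureOriented d →
        SameRegionKerrDecomposition d

end Sig

/-! ## §1 The three REGISTERED stubs (expanded, def-free signatures; the only `sorry`s of the file) -/

/-- **S1 · `futureEquivariantKerrIsometry`** — an `I⁺`-regular vacuum stationary AF black hole with
non-degenerate Killing collars whose d.o.c. is (abstractly) isometric to a sub-extremal Kerr exterior admits a
FUTURE-NORMALISED `T`-EQUIVARIANT isometric embedding `Ψ` of the Kerr–Schild exterior onto `⟨⟨M_ext⟩⟩`
(`dΨ(e₀) = c T`, `c > 0`). Why plausibly true: Killing algebra of Kerr/Schwarzschild + `T` timelike on the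
orbit of an AF end + the backwards isometry (O'Neill 1995 §3.1; Chruściel–Costa 2008 Thm 1.3). Why it might
fail: only through the typing of H2 (the `Diffeomorph` must be inverted and its `mfderiv`s related to those of
a total map on `E4`) — mathematically it is classical. Size M/L. -/
theorem stub_futureEquivariantKerrIsometry : ∀ (𝓑 : Literature.Geometry.Lorentzian.StationaryAFBlackHole.{0}), (∀ [𝓑.metric.HasLeviCivita], 𝓑.IsIPlusRegular ∧ 𝓑.metric.toPseudoRiemannianMetric.IsRicciFlat ∧ 𝓑.horizon.Nonempty ∧ (∀ p ∈ 𝓑.horizon, ∃ (U : Set 𝓑.carrier) (K : Π x : 𝓑.carrier, TangentSpace (𝓡 4) x) (κ : ℝ), IsOpen U ∧ connectedComponentIn 𝓑.horizon p ⊆ U ∧ ContMDiffOn (𝓡 4) ((𝓡 4).prod 𝓘(ℝ, Literature.Geometry.Lorentzian.E4)) ((⊤ : ℕ∞) : WithTop ℕ∞) (fun x ↦ (Bundle.TotalSpace.mk' Literature.Geometry.Lorentzian.E4 x (K x) : TangentBundle (𝓡 4) 𝓑.carrier)) U ∧ (∀ x ∈ U, ∀ v w : TangentSpace (𝓡 4)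 x, 𝓑.metric.val x (𝓑.metric.leviCivita K x v) w + 𝓑.metric.val x v (𝓑.metric.leviCivita K x w) = 0) ∧ (∀ x ∈ U, VectorField.mlieBracket (𝓡 4) 𝓑.killing K x = 0) ∧ (∀ q ∈ connectedComponentIn 𝓑.horizon p, K q ≠ 0) ∧ (∀ γ : ℝ → 𝓑.carrier, IsMIntegralCurve γ K → γ 0 ∈ connectedComponentIn 𝓑.horizon p → ∀ t, γ t ∈ 𝓑.horizon) ∧ κ ≠ 0 ∧ ∀ q ∈ connectedComponentIn 𝓑.horizon p, 𝓑.metric.leviCivita K q (K q) = κ • K q)) → (∀ [𝓑.metric.HasLeviCivita] [Literature.Geometry.Lorentzian.Kerr.Facts] (hF : 𝓑.metric.isOpen_chronologicalFuture 𝓑.timeOrientation) (hP : 𝓑.metric.isOpen_chronologicalPast 𝓑.timeOrientation), (∃ (M a : ℝ) (_ : Literature.Geometry.Lorentzian.Kerr.IsSubextremal M a) (Φ : Diffeomorph (𝓡 4) 𝓘(ℝ, Literature.Geometry.Lorentzian.E4) (𝓑.docOpens hF hP) (Literature.Geometry.Lorentzian.Kerr.exterior M a) ((⊤ : ℕ∞)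 : WithTop ℕ∞)), ∀ (y : 𝓑.docOpens hF hP) (v w : EuclideanSpace ℝ (Fin 4)), (Literature.Geometry.Lorentzian.Kerr.smoothMetric M a (Literature.Geometry.Lorentzian.Kerr.rPlus M a)).val (Φ y) (mfderiv (𝓡 4) 𝓘(ℝ, Literature.Geometry.Lorentzian.E4) Φ y v) (mfderiv (𝓡 4) 𝓘(ℝ, Literature.Geometry.Lorentzian.E4) Φ y w) = 𝓑.metric.val y.1 v w)) → ∃ (M a c : ℝ) (Ψ : Literature.Geometry.Lorentzian.E4 → 𝓑.carrier), Literature.Geometry.Lorentzian.Kerr.IsSubextremal M a ∧ 0 < c ∧ ContMDiffOn 𝓘(ℝ, Literature.Geometry.Lorentzian.E4) (𝓡 4) ((⊤ : ℕ∞) : WithTop ℕ∞) Ψ (Literature.Geometry.Lorentzian.Kerr.exterior M a : Set Literature.Geometry.Lorentzian.E4) ∧ Set.InjOn Ψ (Literature.Geometry.Lorentzian.Kerr.exterior M a : Set Literature.Geometry.Lorentzian.E4) ∧ Ψ '' (Literature.Geometry.Lorentzian.Kerr.exterior M a : Set Literature.Geometry.Lorentzian.E4) = 𝓑.doc ∧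 (∀ x ∈ (Literature.Geometry.Lorentzian.Kerr.exterior M a : Set Literature.Geometry.Lorentzian.E4), mfderiv 𝓘(ℝ, Literature.Geometry.Lorentzian.E4) (𝓡 4) Ψ x (Literature.Geometry.Lorentzian.E4.basisVector 0) = c • 𝓑.killing (Ψ x)) ∧ (∀ x ∈ (Literature.Geometry.Lorentzian.Kerr.exterior M a : Set Literature.Geometry.Lorentzian.E4), ∀ v w : Literature.Geometry.Lorentzian.E4, 𝓑.metric.val (Ψ x) (mfderiv 𝓘(ℝ, Literature.Geometry.Lorentzian.E4) (𝓡 4) Ψ x v) (mfderiv 𝓘(ℝ, Literature.Geometry.Lorentzian.E4) (𝓡 4) Ψ x w) = Literature.Geometry.Lorentzian.Kerr.bilin M a x v w) := by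
  sorry

/-- **S2 · `collarHorizonExtension`** — boundary regularity at `𝓗⁺`: with a non-degenerate Killing collar on
every horizon component (H1) and an immersive adapted chart covering `𝓔⁺` (H3), a future-normalised
`T`-equivariant isometric embedding of the Kerr exterior onto the d.o.c. extends to a smooth injective
infinitesimally `T`-equivariant map of a horizon-penetrating Kerr–Schild region `{r > r₀}`, `r₋ < r₀ < r₊`, into
`range A` (no isometry asked behind `𝓗⁺`). Why plausibly true: both metrics are smooth across their future
horizons, ingoing principal null geodesics cross `r = r₊` at finite affine parameter and isometries map
geodesics to geodesics; the collar supplies the non-degenerate near-horizon structure (Chruściel–Costa 2008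
§4.1–4.3, Prop 4.1–4.8, Thm 4.11). Why it might fail: the image null geodesics might fail to cross `𝓔⁺` inside
`range A` uniformly along the (possibly several) horizon components; = sibling F3 `KerrHorizonExtension`
("NONE-EXISTS in print"). Size L. -/
theorem stub_collarHorizonExtension : ∀ (𝓑 : Literature.Geometry.Lorentzian.StationaryAFBlackHole.{0}) (A : 𝓑.AdaptedChart) (M a c : ℝ) (Ψ : Literature.Geometry.Lorentzian.E4 → 𝓑.carrier), (∀ [𝓑.metric.HasLeviCivita], 𝓑.IsIPlusRegular ∧ 𝓑.metric.toPseudoRiemannianMetric.IsRicciFlat ∧ 𝓑.horizon.Nonempty ∧ (∀ p ∈ 𝓑.horizon, ∃ (U : Set 𝓑.carrier) (K : Π x : 𝓑.carrier, TangentSpace (𝓡 4) x) (κ : ℝ), IsOpen U ∧ connectedComponentIn 𝓑.horizon p ⊆ U ∧ ContMDiffOn (𝓡 4) ((𝓡 4).prod 𝓘(ℝ, Literature.Geometry.Lorentzian.E4)) ((⊤ : ℕ∞) : WithTop ℕ∞) (fun x ↦ (Bundle.TotalSpace.mk' Literature.Geometry.Lorentzian.E4 x (K x) : TangentBundle (𝓡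 4) 𝓑.carrier)) U ∧ (∀ x ∈ U, ∀ v w : TangentSpace (𝓡 4) x, 𝓑.metric.val x (𝓑.metric.leviCivita K x v) w + 𝓑.metric.val x v (𝓑.metric.leviCivita K x w) = 0) ∧ (∀ x ∈ U, VectorField.mlieBracket (𝓡 4) 𝓑.killing K x = 0) ∧ (∀ q ∈ connectedComponentIn 𝓑.horizon p, K q ≠ 0) ∧ (∀ γ : ℝ → 𝓑.carrier, IsMIntegralCurve γ K → γ 0 ∈ connectedComponentIn 𝓑.horizon p → ∀ t, γ t ∈ 𝓑.horizon) ∧ κ ≠ 0 ∧ ∀ q ∈ connectedComponentIn 𝓑.horizon p, 𝓑.metric.leviCivita K q (K q) = κ • K q)) → ((∀ x, Function.Injective (mfderiv 𝓘(ℝ, Literature.Geometry.Lorentzian.E4) (𝓡 4) A.toFun x)) ∧ 𝓑.horizon ⊆ Set.range A.toFun) → Literature.Geometry.Lorentzian.Kerr.IsSubextremal M a → 0 < c → ContMDiffOn 𝓘(ℝ, Literature.Geometry.Lorentzian.E4) (𝓡 4) ((⊤ : ℕ∞) : WithTop ℕ∞) Ψ (Literature.Geometry.Lorentzian.Kerr.exterior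 M a : Set Literature.Geometry.Lorentzian.E4) → Set.InjOn Ψ (Literature.Geometry.Lorentzian.Kerr.exterior M a : Set Literature.Geometry.Lorentzian.E4) → Ψ '' (Literature.Geometry.Lorentzian.Kerr.exterior M a : Set Literature.Geometry.Lorentzian.E4) = 𝓑.doc → (∀ x ∈ (Literature.Geometry.Lorentzian.Kerr.exterior M a : Set Literature.Geometry.Lorentzian.E4), mfderiv 𝓘(ℝ, Literature.Geometry.Lorentzian.E4) (𝓡 4) Ψ x (Literature.Geometry.Lorentzian.E4.basisVector 0) = c • 𝓑.killing (Ψ x)) → (∀ x ∈ (Literature.Geometry.Lorentzian.Kerr.exterior M a : Set Literature.Geometry.Lorentzian.E4), ∀ v w : Literature.Geometry.Lorentzian.E4, 𝓑.metric.val (Ψ x) (mfderiv 𝓘(ℝ, Literature.Geometry.Lorentzian.E4) (𝓡 4) Ψ x v) (mfderiv 𝓘(ℝ, Literature.Geometry.Lorentzian.E4) (𝓡 4) Ψ x w) = Literature.Geometry.Lorentzian.Kerr.bilin M a x v w) → ∃ (r₀ : ℝ) (Φ : Literature.Geometry.Lorentzian.E4 → 𝓑.carrier), Literature.Geometry.Lorentzian.Kerr.rMinus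 M a < r₀ ∧ r₀ < Literature.Geometry.Lorentzian.Kerr.rPlus M a ∧ ContMDiffOn 𝓘(ℝ, Literature.Geometry.Lorentzian.E4) (𝓡 4) ((⊤ : ℕ∞) : WithTop ℕ∞) Φ (Literature.Geometry.Lorentzian.Kerr.region a r₀ : Set Literature.Geometry.Lorentzian.E4) ∧ Set.InjOn Φ (Literature.Geometry.Lorentzian.Kerr.region a r₀ : Set Literature.Geometry.Lorentzian.E4) ∧ Set.MapsTo Φ (Literature.Geometry.Lorentzian.Kerr.region a r₀ : Set Literature.Geometry.Lorentzian.E4) (Set.range A.toFun) ∧ (∀ x ∈ (Literature.Geometry.Lorentzian.Kerr.region a r₀ : Set Literature.Geometry.Lorentzian.E4), mfderiv 𝓘(ℝ, Literature.Geometry.Lorentzian.E4) (𝓡 4) Φ x (Literature.Geometry.Lorentzian.E4.basisVector 0) = c • 𝓑.killing (Φ x)) ∧ (∀ x ∈ (Literature.Geometry.Lorentzian.Kerr.exterior M a : Set Literature.Geometry.Lorentzian.E4), ∀ v w : Literature.Geometry.Lorentzian.E4, 𝓑.metric.val (Φ x) (mfderiv 𝓘(ℝ, Literature.Geometry.Lorentzian.E4)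 (𝓡 4) Φ x v) (mfderiv 𝓘(ℝ, Literature.Geometry.Lorentzian.E4) (𝓡 4) Φ x w) = Literature.Geometry.Lorentzian.Kerr.bilin M a x v w) ∧ Φ '' (Literature.Geometry.Lorentzian.Kerr.exterior M a : Set Literature.Geometry.Lorentzian.E4) = 𝓑.doc ∧ ∀ x ∈ (Literature.Geometry.Lorentzian.Kerr.exterior M a : Set Literature.Geometry.Lorentzian.E4), Φ x = Ψ x := by
  sorry

/-- **S3 · `sameRegionTransfer`** — node "RebuildDecomposition": the crux with H2 replaced by the chart-level
identification `IsKerrCharted (d.hole i) (d.adapted i)` of every hole. Why plausibly true (as far as it is):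
`C²` convergence moves through the `C³`-regular, time-equivariant transition `Θᵢ` to truncated Kerr–Schild
slabs of every FIXED radius (compactness of `{t* = 0, r₊ ≤ r ≤ R}`), honest radii can be grown diagonally,
orientation is `kerrIdentificationFuture`; the transfer itself is `StationaryFinalStateDecomposition.
toFinalStateDecomposition` once charts are `IsKerr`. WHY IT MIGHT FAIL (refuter, BirthAttack.md §1–3): the
SAME-`O` exhaustion clause and `d'.charted = d.charted` are false in exact Kerr with a plunging collar chart —
this stub carries that objection in full. Size L. -/
theorem stub_sameRegionTransfer : ∀ (𝓢 : Literature.Geometry.Lorentzian.Spacetime.{0} 4) (O : Set 𝓢.carrier) (d : Literature.Geometry.Lorentzian.StationaryFinalStateDecomposition 𝓢 O 2), (∀ i, (∀ [(d.hole i).metric.HasLeviCivita], (d.hole i).IsIPlusRegular ∧ (d.hole i).metric.toPseudoRiemannianMetric.IsRicciFlat ∧ (d.hole i).horizon.Nonempty ∧ (∀ p ∈ (d.hole i).horizon, ∃ (U : Set (d.hole i).carrier) (K : Π x : (d.hole i).carrier, TangentSpace (𝓡 4) x) (κ : ℝ), IsOpen U ∧ connectedComponentIn (d.hole i).horizon p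 ⊆ U ∧ ContMDiffOn (𝓡 4) ((𝓡 4).prod 𝓘(ℝ, Literature.Geometry.Lorentzian.E4)) ((⊤ : ℕ∞) : WithTop ℕ∞) (fun x ↦ (Bundle.TotalSpace.mk' Literature.Geometry.Lorentzian.E4 x (K x) : TangentBundle (𝓡 4) (d.hole i).carrier)) U ∧ (∀ x ∈ U, ∀ v w : TangentSpace (𝓡 4) x, (d.hole i).metric.val x ((d.hole i).metric.leviCivita K x v) w + (d.hole i).metric.val x v ((d.hole i).metric.leviCivita K x w) = 0) ∧ (∀ x ∈ U, VectorField.mlieBracket (𝓡 4) (d.hole i).killing K x = 0) ∧ (∀ q ∈ connectedComponentIn (d.hole i).horizon p, K q ≠ 0) ∧ (∀ γ : ℝ → (d.hole i).carrier, IsMIntegralCurve γ K → γ 0 ∈ connectedComponentIn (d.hole i).horizon p → ∀ t, γ t ∈ (d.hole i).horizon) ∧ κ ≠ 0 ∧ ∀ q ∈ connectedComponentIn (d.hole i).horizon p, (d.hole i).metric.leviCivita K q (K q) = κ • K q))) → (∀ i, Summit.FinalStateConjecture.FinalStateConjecture.Theorems.SymplecticDualOfTheBomb.IsKerrCharted (d.hole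 i) (d.adapted i)) → (∀ i, (∀ x, Function.Injective (mfderiv 𝓘(ℝ, Literature.Geometry.Lorentzian.E4) (𝓡 4) (d.adapted i).toFun x)) ∧ (d.hole i).horizon ⊆ Set.range (d.adapted i).toFun) → (∃ R : Fin d.N → ℝ → ℝ, (∀ i, Filter.Tendsto (R i) Filter.atTop Filter.atTop) ∧ (∀ i, Filter.Tendsto (fun τ ↦ 𝓢.truncDeviationCk (d.background i) (d.toOver.chart i) 2 (R i τ) τ) Filter.atTop (nhds 0)) ∧ ∀ τ₁ : ℝ, d.toOver.τ₀ < τ₁ → O \ d.toOver.certifiedLate R τ₁ ⊆ 𝓢.metric.causalPast 𝓢.timeOrientation (d.toOver.certifiedSlab R τ₁)) → ((∀ i, Summit.FinalStateConjecture.IsOrthochronous (d.motion i).1) ∧ (∀ i (ρ : ℝ), ∀ᶠ τ in Filter.atTop, ∀ x ∈ (d.background i).truncTimeSlab ρ τ, ∀ v : Literature.Geometry.Lorentzian.E4, mfderiv 𝓘(ℝ, Literature.Geometry.Lorentzian.E4) (𝓡 4) (d.adapted i).toFun ⟨Literature.Geometry.Lorentzian.poincareInv (d.motion i).1 (d.motion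 i).2 x.1, x.2⟩ v = (d.hole i).timeOrientation.vectorField ((d.adapted i).toFun ⟨Literature.Geometry.Lorentzian.poincareInv (d.motion i).1 (d.motion i).2 x.1, x.2⟩) → 𝓢.timeOrientation.IsFutureDirected (mfderiv 𝓘(ℝ, Literature.Geometry.Lorentzian.E4) (𝓡 4) (d.toOver.chart i) x (((d.motion i).1 : Literature.Geometry.Lorentzian.E4 ≃L[ℝ] Literature.Geometry.Lorentzian.E4) v))) ∧ ∀ᶠ τ in Filter.atTop, ∀ x ∈ (Literature.Geometry.Lorentzian.Minkowski.backgroundOn d.toOver.flatDomain).timeSlab τ, 𝓢.timeOrientation.IsFutureDirected (mfderiv 𝓘(ℝ, Literature.Geometry.Lorentzian.E4) (𝓡 4) d.toOver.flatChart x (Literature.Geometry.Lorentzian.E4.basisVector 0))) → ∃ d' : Literature.Geometry.Lorentzian.FinalStateDecomposition 𝓢 O 2, (∀ i, Literature.Geometry.Lorentzian.Kerr.IsSubextremal (d'.mass i) (d'.spin i)) ∧ d'.charted = d.charted ∧ Summit.FinalStateConjecture.HasExhaustiveCharts d' ∧ Summit.FinalStateConjecture.IsFutureOriented d' := by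
  sorry

/-! ## §2 The registered texts are the §0 statements (definitional sanity) -/

theorem stub_futureEquivariantKerrIsometry_iff :
    (∀ (𝓑 : Literature.Geometry.Lorentzian.StationaryAFBlackHole.{0}), (∀ [𝓑.metric.HasLeviCivita], 𝓑.IsIPlusRegular ∧ 𝓑.metric.toPseudoRiemannianMetric.IsRicciFlat ∧ 𝓑.horizon.Nonempty ∧ (∀ p ∈ 𝓑.horizon, ∃ (U : Set 𝓑.carrier) (K : Π x : 𝓑.carrier, TangentSpace (𝓡 4) x) (κ : ℝ), IsOpen U ∧ connectedComponentIn 𝓑.horizon p ⊆ U ∧ ContMDiffOn (𝓡 4) ((𝓡 4).prod 𝓘(ℝ, Literature.Geometry.Lorentzian.E4)) ((⊤ : ℕ∞) : WithTop ℕ∞) (fun x ↦ (Bundle.TotalSpace.mk' Literature.Geometry.Lorentzian.E4 x (K x) : TangentBundle (𝓡 4) 𝓑.carrier)) U ∧ (∀ x ∈ U, ∀ v w : TangentSpace (𝓡 4) x, 𝓑.metric.val x (𝓑.metric.leviCivita K x v) w + 𝓑.metric.val x v (𝓑.metric.leviCivita K x w) = 0) ∧ (∀ x ∈ U, VectorField.mlieBracket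 (𝓡 4) 𝓑.killing K x = 0) ∧ (∀ q ∈ connectedComponentIn 𝓑.horizon p, K q ≠ 0) ∧ (∀ γ : ℝ → 𝓑.carrier, IsMIntegralCurve γ K → γ 0 ∈ connectedComponentIn 𝓑.horizon p → ∀ t, γ t ∈ 𝓑.horizon) ∧ κ ≠ 0 ∧ ∀ q ∈ connectedComponentIn 𝓑.horizon p, 𝓑.metric.leviCivita K q (K q) = κ • K q)) → (∀ [𝓑.metric.HasLeviCivita] [Literature.Geometry.Lorentzian.Kerr.Facts] (hF : 𝓑.metric.isOpen_chronologicalFuture 𝓑.timeOrientation) (hP : 𝓑.metric.isOpen_chronologicalPast 𝓑.timeOrientation), (∃ (M a : ℝ) (_ : Literature.Geometry.Lorentzian.Kerr.IsSubextremal M a) (Φ : Diffeomorph (𝓡 4) 𝓘(ℝ, Literature.Geometry.Lorentzian.E4) (𝓑.docOpens hF hP) (Literature.Geometry.Lorentzian.Kerr.exterior M a) ((⊤ : ℕ∞) : WithTop ℕ∞)), ∀ (y : 𝓑.docOpens hF hP) (v w : EuclideanSpace ℝ (Fin 4)), (Literature.Geometry.Lorentzian.Kerr.smoothMetric M a (Literature.Geometry.Lorentzian.Kerr.rPlus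 M a)).val (Φ y) (mfderiv (𝓡 4) 𝓘(ℝ, Literature.Geometry.Lorentzian.E4) Φ y v) (mfderiv (𝓡 4) 𝓘(ℝ, Literature.Geometry.Lorentzian.E4) Φ y w) = 𝓑.metric.val y.1 v w)) → ∃ (M a c : ℝ) (Ψ : Literature.Geometry.Lorentzian.E4 → 𝓑.carrier), Literature.Geometry.Lorentzian.Kerr.IsSubextremal M a ∧ 0 < c ∧ ContMDiffOn 𝓘(ℝ, Literature.Geometry.Lorentzian.E4) (𝓡 4) ((⊤ : ℕ∞) : WithTop ℕ∞) Ψ (Literature.Geometry.Lorentzian.Kerr.exterior M a : Set Literature.Geometry.Lorentzian.E4) ∧ Set.InjOn Ψ (Literature.Geometry.Lorentzian.Kerr.exterior M a : Set Literature.Geometry.Lorentzian.E4) ∧ Ψ '' (Literature.Geometry.Lorentzian.Kerr.exterior M a : Set Literature.Geometry.Lorentzian.E4) = 𝓑.doc ∧ (∀ x ∈ (Literature.Geometry.Lorentzian.Kerr.exterior M a : Set Literature.Geometry.Lorentzian.E4), mfderiv 𝓘(ℝ, Literature.Geometry.Lorentzian.E4) (𝓡 4) Ψ x (Literature.Geometry.Lorentzian.E4.basisVector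 0) = c • 𝓑.killing (Ψ x)) ∧ (∀ x ∈ (Literature.Geometry.Lorentzian.Kerr.exterior M a : Set Literature.Geometry.Lorentzian.E4), ∀ v w : Literature.Geometry.Lorentzian.E4, 𝓑.metric.val (Ψ x) (mfderiv 𝓘(ℝ, Literature.Geometry.Lorentzian.E4) (𝓡 4) Ψ x v) (mfderiv 𝓘(ℝ, Literature.Geometry.Lorentzian.E4) (𝓡 4) Ψ x w) = Literature.Geometry.Lorentzian.Kerr.bilin M a x v w)) ↔ Sig.stub_futureEquivariantKerrIsometry :=
  Iff.rfl

theorem stub_collarHorizonExtension_iff :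
    (∀ (𝓑 : Literature.Geometry.Lorentzian.StationaryAFBlackHole.{0}) (A : 𝓑.AdaptedChart) (M a c : ℝ) (Ψ : Literature.Geometry.Lorentzian.E4 → 𝓑.carrier), (∀ [𝓑.metric.HasLeviCivita], 𝓑.IsIPlusRegular ∧ 𝓑.metric.toPseudoRiemannianMetric.IsRicciFlat ∧ 𝓑.horizon.Nonempty ∧ (∀ p ∈ 𝓑.horizon, ∃ (U : Set 𝓑.carrier) (K : Π x : 𝓑.carrier, TangentSpace (𝓡 4) x) (κ : ℝ), IsOpen U ∧ connectedComponentIn 𝓑.horizon p ⊆ U ∧ ContMDiffOn (𝓡 4) ((𝓡 4).prod 𝓘(ℝ, Literature.Geometry.Lorentzian.E4)) ((⊤ : ℕ∞) : WithTop ℕ∞) (fun x ↦ (Bundle.TotalSpace.mk' Literature.Geometry.Lorentzian.E4 x (K x) : TangentBundle (𝓡 4) 𝓑.carrier)) U ∧ (∀ x ∈ U, ∀ v w : TangentSpace (𝓡 4) x, 𝓑.metric.val x (𝓑.metric.leviCivita K x v) w + 𝓑.metric.val x v (𝓑.metric.leviCivita K x w) = 0) ∧ (∀ x ∈ U, VectorField.mlieBracket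 (𝓡 4) 𝓑.killing K x = 0) ∧ (∀ q ∈ connectedComponentIn 𝓑.horizon p, K q ≠ 0) ∧ (∀ γ : ℝ → 𝓑.carrier, IsMIntegralCurve γ K → γ 0 ∈ connectedComponentIn 𝓑.horizon p → ∀ t, γ t ∈ 𝓑.horizon) ∧ κ ≠ 0 ∧ ∀ q ∈ connectedComponentIn 𝓑.horizon p, 𝓑.metric.leviCivita K q (K q) = κ • K q)) → ((∀ x, Function.Injective (mfderiv 𝓘(ℝ, Literature.Geometry.Lorentzian.E4) (𝓡 4) A.toFun x)) ∧ 𝓑.horizon ⊆ Set.range A.toFun) → Literature.Geometry.Lorentzian.Kerr.IsSubextremal M a → 0 < c → ContMDiffOn 𝓘(ℝ, Literature.Geometry.Lorentzian.E4) (𝓡 4) ((⊤ : ℕ∞) : WithTop ℕ∞) Ψ (Literature.Geometry.Lorentzian.Kerr.exterior M a : Set Literature.Geometry.Lorentzian.E4) → Set.InjOn Ψ (Literature.Geometry.Lorentzian.Kerr.exterior M a : Set Literature.Geometry.Lorentzian.E4) → Ψ '' (Literature.Geometry.Lorentzian.Kerr.exterior M a : Set Literature.Geometry.Lorentzian.E4)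 = 𝓑.doc → (∀ x ∈ (Literature.Geometry.Lorentzian.Kerr.exterior M a : Set Literature.Geometry.Lorentzian.E4), mfderiv 𝓘(ℝ, Literature.Geometry.Lorentzian.E4) (𝓡 4) Ψ x (Literature.Geometry.Lorentzian.E4.basisVector 0) = c • 𝓑.killing (Ψ x)) → (∀ x ∈ (Literature.Geometry.Lorentzian.Kerr.exterior M a : Set Literature.Geometry.Lorentzian.E4), ∀ v w : Literature.Geometry.Lorentzian.E4, 𝓑.metric.val (Ψ x) (mfderiv 𝓘(ℝ, Literature.Geometry.Lorentzian.E4) (𝓡 4) Ψ x v) (mfderiv 𝓘(ℝ, Literature.Geometry.Lorentzian.E4) (𝓡 4) Ψ x w) = Literature.Geometry.Lorentzian.Kerr.bilin M a x v w) → ∃ (r₀ : ℝ) (Φ : Literature.Geometry.Lorentzian.E4 → 𝓑.carrier), Literature.Geometry.Lorentzian.Kerr.rMinus M a < r₀ ∧ r₀ < Literature.Geometry.Lorentzian.Kerr.rPlus M a ∧ ContMDiffOn 𝓘(ℝ, Literature.Geometry.Lorentzian.E4) (𝓡 4) ((⊤ : ℕ∞) : WithTop ℕ∞) Φ (Literature.Geometry.Lorentzian.Kerr.region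 a r₀ : Set Literature.Geometry.Lorentzian.E4) ∧ Set.InjOn Φ (Literature.Geometry.Lorentzian.Kerr.region a r₀ : Set Literature.Geometry.Lorentzian.E4) ∧ Set.MapsTo Φ (Literature.Geometry.Lorentzian.Kerr.region a r₀ : Set Literature.Geometry.Lorentzian.E4) (Set.range A.toFun) ∧ (∀ x ∈ (Literature.Geometry.Lorentzian.Kerr.region a r₀ : Set Literature.Geometry.Lorentzian.E4), mfderiv 𝓘(ℝ, Literature.Geometry.Lorentzian.E4) (𝓡 4) Φ x (Literature.Geometry.Lorentzian.E4.basisVector 0) = c • 𝓑.killing (Φ x)) ∧ (∀ x ∈ (Literature.Geometry.Lorentzian.Kerr.exterior M a : Set Literature.Geometry.Lorentzian.E4), ∀ v w : Literature.Geometry.Lorentzian.E4, 𝓑.metric.val (Φ x) (mfderiv 𝓘(ℝ, Literature.Geometry.Lorentzian.E4) (𝓡 4) Φ x v) (mfderiv 𝓘(ℝ, Literature.Geometry.Lorentzian.E4) (𝓡 4) Φ x w) = Literature.Geometry.Lorentzian.Kerr.bilin M a x v w) ∧ Φ '' (Literature.Geometry.Lorentzian.Kerr.exterior M a : Set Literature.Geometry.Lorentzian.E4)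 = 𝓑.doc ∧ ∀ x ∈ (Literature.Geometry.Lorentzian.Kerr.exterior M a : Set Literature.Geometry.Lorentzian.E4), Φ x = Ψ x) ↔ Sig.stub_collarHorizonExtension :=
  Iff.rfl

theorem stub_sameRegionTransfer_iff :
    (∀ (𝓢 : Literature.Geometry.Lorentzian.Spacetime.{0} 4) (O : Set 𝓢.carrier) (d : Literature.Geometry.Lorentzian.StationaryFinalStateDecomposition 𝓢 O 2), (∀ i, (∀ [(d.hole i).metric.HasLeviCivita], (d.hole i).IsIPlusRegular ∧ (d.hole i).metric.toPseudoRiemannianMetric.IsRicciFlat ∧ (d.hole i).horizon.Nonempty ∧ (∀ p ∈ (d.hole i).horizon, ∃ (U : Set (d.hole i).carrier) (K : Π x : (d.hole i).carrier, TangentSpace (𝓡 4) x) (κ : ℝ), IsOpen U ∧ connectedComponentIn (d.hole i).horizon p ⊆ U ∧ ContMDiffOn (𝓡 4) ((𝓡 4).prod 𝓘(ℝ, Literature.Geometry.Lorentzian.E4)) ((⊤ : ℕ∞) : WithTop ℕ∞) (fun x ↦ (Bundle.TotalSpace.mk' Literature.Geometry.Lorentzian.E4 x (K x) : TangentBundle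 (𝓡 4) (d.hole i).carrier)) U ∧ (∀ x ∈ U, ∀ v w : TangentSpace (𝓡 4) x, (d.hole i).metric.val x ((d.hole i).metric.leviCivita K x v) w + (d.hole i).metric.val x v ((d.hole i).metric.leviCivita K x w) = 0) ∧ (∀ x ∈ U, VectorField.mlieBracket (𝓡 4) (d.hole i).killing K x = 0) ∧ (∀ q ∈ connectedComponentIn (d.hole i).horizon p, K q ≠ 0) ∧ (∀ γ : ℝ → (d.hole i).carrier, IsMIntegralCurve γ K → γ 0 ∈ connectedComponentIn (d.hole i).horizon p → ∀ t, γ t ∈ (d.hole i).horizon) ∧ κ ≠ 0 ∧ ∀ q ∈ connectedComponentIn (d.hole i).horizon p, (d.hole i).metric.leviCivita K q (K q) = κ • K q))) → (∀ i, Summit.FinalStateConjecture.FinalStateConjecture.Theorems.SymplecticDualOfTheBomb.IsKerrCharted (d.hole i) (d.adapted i)) → (∀ i, (∀ x, Function.Injective (mfderiv 𝓘(ℝ, Literature.Geometry.Lorentzian.E4) (𝓡 4) (d.adapted i).toFun x)) ∧ (d.hole i).horizon ⊆ Set.range (d.adapted i).toFun) → (∃ R : Fin d.N → ℝ → ℝ,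 (∀ i, Filter.Tendsto (R i) Filter.atTop Filter.atTop) ∧ (∀ i, Filter.Tendsto (fun τ ↦ 𝓢.truncDeviationCk (d.background i) (d.toOver.chart i) 2 (R i τ) τ) Filter.atTop (nhds 0)) ∧ ∀ τ₁ : ℝ, d.toOver.τ₀ < τ₁ → O \ d.toOver.certifiedLate R τ₁ ⊆ 𝓢.metric.causalPast 𝓢.timeOrientation (d.toOver.certifiedSlab R τ₁)) → ((∀ i, Summit.FinalStateConjecture.IsOrthochronous (d.motion i).1) ∧ (∀ i (ρ : ℝ), ∀ᶠ τ in Filter.atTop, ∀ x ∈ (d.background i).truncTimeSlab ρ τ, ∀ v : Literature.Geometry.Lorentzian.E4, mfderiv 𝓘(ℝ, Literature.Geometry.Lorentzian.E4) (𝓡 4) (d.adapted i).toFun ⟨Literature.Geometry.Lorentzian.poincareInv (d.motion i).1 (d.motion i).2 x.1, x.2⟩ v = (d.hole i).timeOrientation.vectorField ((d.adapted i).toFun ⟨Literature.Geometry.Lorentzian.poincareInv (d.motion i).1 (d.motion i).2 x.1, x.2⟩) → 𝓢.timeOrientation.IsFutureDirected (mfderiv 𝓘(ℝ, Literature.Geometry.Lorentzian.E4)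 (𝓡 4) (d.toOver.chart i) x (((d.motion i).1 : Literature.Geometry.Lorentzian.E4 ≃L[ℝ] Literature.Geometry.Lorentzian.E4) v))) ∧ ∀ᶠ τ in Filter.atTop, ∀ x ∈ (Literature.Geometry.Lorentzian.Minkowski.backgroundOn d.toOver.flatDomain).timeSlab τ, 𝓢.timeOrientation.IsFutureDirected (mfderiv 𝓘(ℝ, Literature.Geometry.Lorentzian.E4) (𝓡 4) d.toOver.flatChart x (Literature.Geometry.Lorentzian.E4.basisVector 0))) → ∃ d' : Literature.Geometry.Lorentzian.FinalStateDecomposition 𝓢 O 2, (∀ i, Literature.Geometry.Lorentzian.Kerr.IsSubextremal (d'.mass i) (d'.spin i)) ∧ d'.charted = d.charted ∧ Summit.FinalStateConjecture.HasExhaustiveCharts d' ∧ Summit.FinalStateConjecture.IsFutureOriented d') ↔ Sig.stub_sameRegionTransfer :=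
  Iff.rfl

/-! ## §3 Composition (sorry-free): S1 → S2 → landed `isKerrCharted_of_chartedExtension` → S3 -/

/-- Per hole: S1 and S2 and the LANDED reduction give the chart-level Kerr identification. -/
theorem isKerrCharted_of_stubs (h₁ : Sig.stub_futureEquivariantKerrIsometry)
    (h₂ : Sig.stub_collarHorizonExtension) (𝓑 : Literature.Geometry.Lorentzian.StationaryAFBlackHole.{0}) (A : 𝓑.AdaptedChart)
    (hreg : HoleRegular 𝓑) (hiso : DocIsometricToKerr 𝓑) (hch : ChartPenetrating A) :
    Summit.FinalStateConjecture.FinalStateConjecture.Theorems.SymplecticDualOfTheBomb.IsKerrCharted 𝓑 A := by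
  obtain ⟨M, a, c, Ψ, hsub, hc, hΨs, hΨi, hΨim, hΨT, hΨg⟩ := h₁ 𝓑 hreg hiso
  obtain ⟨r₀, Φ, hrm, hrp, hΦs, hΦi, hΦm, hΦT, hΦg, hΦim, -⟩ :=
    h₂ 𝓑 A M a c Ψ hreg hch hsub hc hΨs hΨi hΨim hΨT hΨg
  exact isKerrCharted_of_chartedExtension 𝓑 A M a c r₀ Φ hsub hc hrm hrp hch.1 hΦs hΦi hΦm hΦT hΦg hΦim

/-- **The composition, concluding the crux BY NAME.** -/
theorem KerrChartTransfer_of :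
    (∀ (𝓑 : Literature.Geometry.Lorentzian.StationaryAFBlackHole.{0}), (∀ [𝓑.metric.HasLeviCivita], 𝓑.IsIPlusRegular ∧ 𝓑.metric.toPseudoRiemannianMetric.IsRicciFlat ∧ 𝓑.horizon.Nonempty ∧ (∀ p ∈ 𝓑.horizon, ∃ (U : Set 𝓑.carrier) (K : Π x : 𝓑.carrier, TangentSpace (𝓡 4) x) (κ : ℝ), IsOpen U ∧ connectedComponentIn 𝓑.horizon p ⊆ U ∧ ContMDiffOn (𝓡 4) ((𝓡 4).prod 𝓘(ℝ, Literature.Geometry.Lorentzian.E4)) ((⊤ : ℕ∞) : WithTop ℕ∞) (fun x ↦ (Bundle.TotalSpace.mk' Literature.Geometry.Lorentzian.E4 x (K x) : TangentBundle (𝓡 4) 𝓑.carrier)) U ∧ (∀ x ∈ U, ∀ v w : TangentSpace (𝓡 4) x, 𝓑.metric.val x (𝓑.metric.leviCivita K x v) w + 𝓑.metric.val x v (𝓑.metric.leviCivita K x w) = 0) ∧ (∀ x ∈ U, VectorField.mlieBracket (𝓡 4) 𝓑.killing K x = 0) ∧ (∀ q ∈ connectedComponentIn 𝓑.horizon p,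 K q ≠ 0) ∧ (∀ γ : ℝ → 𝓑.carrier, IsMIntegralCurve γ K → γ 0 ∈ connectedComponentIn 𝓑.horizon p → ∀ t, γ t ∈ 𝓑.horizon) ∧ κ ≠ 0 ∧ ∀ q ∈ connectedComponentIn 𝓑.horizon p, 𝓑.metric.leviCivita K q (K q) = κ • K q)) → (∀ [𝓑.metric.HasLeviCivita] [Literature.Geometry.Lorentzian.Kerr.Facts] (hF : 𝓑.metric.isOpen_chronologicalFuture 𝓑.timeOrientation) (hP : 𝓑.metric.isOpen_chronologicalPast 𝓑.timeOrientation), (∃ (M a : ℝ) (_ : Literature.Geometry.Lorentzian.Kerr.IsSubextremal M a) (Φ : Diffeomorph (𝓡 4) 𝓘(ℝ, Literature.Geometry.Lorentzian.E4) (𝓑.docOpens hF hP) (Literature.Geometry.Lorentzian.Kerr.exterior M a) ((⊤ : ℕ∞) : WithTop ℕ∞)), ∀ (y : 𝓑.docOpens hF hP) (v w : EuclideanSpace ℝ (Fin 4)), (Literature.Geometry.Lorentzian.Kerr.smoothMetric M a (Literature.Geometry.Lorentzian.Kerr.rPlus M a)).val (Φ y) (mfderiv (𝓡 4) 𝓘(ℝ,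 Literature.Geometry.Lorentzian.E4) Φ y v) (mfderiv (𝓡 4) 𝓘(ℝ, Literature.Geometry.Lorentzian.E4) Φ y w) = 𝓑.metric.val y.1 v w)) → ∃ (M a c : ℝ) (Ψ : Literature.Geometry.Lorentzian.E4 → 𝓑.carrier), Literature.Geometry.Lorentzian.Kerr.IsSubextremal M a ∧ 0 < c ∧ ContMDiffOn 𝓘(ℝ, Literature.Geometry.Lorentzian.E4) (𝓡 4) ((⊤ : ℕ∞) : WithTop ℕ∞) Ψ (Literature.Geometry.Lorentzian.Kerr.exterior M a : Set Literature.Geometry.Lorentzian.E4) ∧ Set.InjOn Ψ (Literature.Geometry.Lorentzian.Kerr.exterior M a : Set Literature.Geometry.Lorentzian.E4) ∧ Ψ '' (Literature.Geometry.Lorentzian.Kerr.exterior M a : Set Literature.Geometry.Lorentzian.E4) = 𝓑.doc ∧ (∀ x ∈ (Literature.Geometry.Lorentzian.Kerr.exterior M a : Set Literature.Geometry.Lorentzian.E4), mfderiv 𝓘(ℝ, Literature.Geometry.Lorentzian.E4) (𝓡 4) Ψ x (Literature.Geometry.Lorentzian.E4.basisVector 0) = c • 𝓑.killing (Ψ x))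 ∧ (∀ x ∈ (Literature.Geometry.Lorentzian.Kerr.exterior M a : Set Literature.Geometry.Lorentzian.E4), ∀ v w : Literature.Geometry.Lorentzian.E4, 𝓑.metric.val (Ψ x) (mfderiv 𝓘(ℝ, Literature.Geometry.Lorentzian.E4) (𝓡 4) Ψ x v) (mfderiv 𝓘(ℝ, Literature.Geometry.Lorentzian.E4) (𝓡 4) Ψ x w) = Literature.Geometry.Lorentzian.Kerr.bilin M a x v w)) →
    (∀ (𝓑 : Literature.Geometry.Lorentzian.StationaryAFBlackHole.{0}) (A : 𝓑.AdaptedChart) (M a c : ℝ) (Ψ : Literature.Geometry.Lorentzian.E4 → 𝓑.carrier), (∀ [𝓑.metric.HasLeviCivita], 𝓑.IsIPlusRegular ∧ 𝓑.metric.toPseudoRiemannianMetric.IsRicciFlat ∧ 𝓑.horizon.Nonempty ∧ (∀ p ∈ 𝓑.horizon, ∃ (U : Set 𝓑.carrier) (K : Π x : 𝓑.carrier, TangentSpace (𝓡 4) x) (κ : ℝ), IsOpen U ∧ connectedComponentIn 𝓑.horizon p ⊆ U ∧ ContMDiffOn (𝓡 4) ((𝓡 4).prod 𝓘(ℝ,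 Literature.Geometry.Lorentzian.E4)) ((⊤ : ℕ∞) : WithTop ℕ∞) (fun x ↦ (Bundle.TotalSpace.mk' Literature.Geometry.Lorentzian.E4 x (K x) : TangentBundle (𝓡 4) 𝓑.carrier)) U ∧ (∀ x ∈ U, ∀ v w : TangentSpace (𝓡 4) x, 𝓑.metric.val x (𝓑.metric.leviCivita K x v) w + 𝓑.metric.val x v (𝓑.metric.leviCivita K x w) = 0) ∧ (∀ x ∈ U, VectorField.mlieBracket (𝓡 4) 𝓑.killing K x = 0) ∧ (∀ q ∈ connectedComponentIn 𝓑.horizon p, K q ≠ 0) ∧ (∀ γ : ℝ → 𝓑.carrier, IsMIntegralCurve γ K → γ 0 ∈ connectedComponentIn 𝓑.horizon p → ∀ t, γ t ∈ 𝓑.horizon) ∧ κ ≠ 0 ∧ ∀ q ∈ connectedComponentIn 𝓑.horizon p, 𝓑.metric.leviCivita K q (K q) = κ • K q)) → ((∀ x, Function.Injective (mfderiv 𝓘(ℝ, Literature.Geometry.Lorentzian.E4) (𝓡 4) A.toFun x)) ∧ 𝓑.horizon ⊆ Set.range A.toFun) → Literature.Geometry.Lorentzian.Kerr.IsSubextremal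 M a → 0 < c → ContMDiffOn 𝓘(ℝ, Literature.Geometry.Lorentzian.E4) (𝓡 4) ((⊤ : ℕ∞) : WithTop ℕ∞) Ψ (Literature.Geometry.Lorentzian.Kerr.exterior M a : Set Literature.Geometry.Lorentzian.E4) → Set.InjOn Ψ (Literature.Geometry.Lorentzian.Kerr.exterior M a : Set Literature.Geometry.Lorentzian.E4) → Ψ '' (Literature.Geometry.Lorentzian.Kerr.exterior M a : Set Literature.Geometry.Lorentzian.E4) = 𝓑.doc → (∀ x ∈ (Literature.Geometry.Lorentzian.Kerr.exterior M a : Set Literature.Geometry.Lorentzian.E4), mfderiv 𝓘(ℝ, Literature.Geometry.Lorentzian.E4) (𝓡 4) Ψ x (Literature.Geometry.Lorentzian.E4.basisVector 0) = c • 𝓑.killing (Ψ x)) → (∀ x ∈ (Literature.Geometry.Lorentzian.Kerr.exterior M a : Set Literature.Geometry.Lorentzian.E4), ∀ v w : Literature.Geometry.Lorentzian.E4, 𝓑.metric.val (Ψ x) (mfderiv 𝓘(ℝ, Literature.Geometry.Lorentzian.E4) (𝓡 4) Ψ x v) (mfderiv 𝓘(ℝ, Literature.Geometry.Lorentzian.E4)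 (𝓡 4) Ψ x w) = Literature.Geometry.Lorentzian.Kerr.bilin M a x v w) → ∃ (r₀ : ℝ) (Φ : Literature.Geometry.Lorentzian.E4 → 𝓑.carrier), Literature.Geometry.Lorentzian.Kerr.rMinus M a < r₀ ∧ r₀ < Literature.Geometry.Lorentzian.Kerr.rPlus M a ∧ ContMDiffOn 𝓘(ℝ, Literature.Geometry.Lorentzian.E4) (𝓡 4) ((⊤ : ℕ∞) : WithTop ℕ∞) Φ (Literature.Geometry.Lorentzian.Kerr.region a r₀ : Set Literature.Geometry.Lorentzian.E4) ∧ Set.InjOn Φ (Literature.Geometry.Lorentzian.Kerr.region a r₀ : Set Literature.Geometry.Lorentzian.E4) ∧ Set.MapsTo Φ (Literature.Geometry.Lorentzian.Kerr.region a r₀ : Set Literature.Geometry.Lorentzian.E4) (Set.range A.toFun) ∧ (∀ x ∈ (Literature.Geometry.Lorentzian.Kerr.region a r₀ : Set Literature.Geometry.Lorentzian.E4), mfderiv 𝓘(ℝ, Literature.Geometry.Lorentzian.E4) (𝓡 4) Φ x (Literature.Geometry.Lorentzian.E4.basisVector 0) = c • 𝓑.killing (Φ x)) ∧ (∀ x ∈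 (Literature.Geometry.Lorentzian.Kerr.exterior M a : Set Literature.Geometry.Lorentzian.E4), ∀ v w : Literature.Geometry.Lorentzian.E4, 𝓑.metric.val (Φ x) (mfderiv 𝓘(ℝ, Literature.Geometry.Lorentzian.E4) (𝓡 4) Φ x v) (mfderiv 𝓘(ℝ, Literature.Geometry.Lorentzian.E4) (𝓡 4) Φ x w) = Literature.Geometry.Lorentzian.Kerr.bilin M a x v w) ∧ Φ '' (Literature.Geometry.Lorentzian.Kerr.exterior M a : Set Literature.Geometry.Lorentzian.E4) = 𝓑.doc ∧ ∀ x ∈ (Literature.Geometry.Lorentzian.Kerr.exterior M a : Set Literature.Geometry.Lorentzian.E4), Φ x = Ψ x) →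
    (∀ (𝓢 : Literature.Geometry.Lorentzian.Spacetime.{0} 4) (O : Set 𝓢.carrier) (d : Literature.Geometry.Lorentzian.StationaryFinalStateDecomposition 𝓢 O 2), (∀ i, (∀ [(d.hole i).metric.HasLeviCivita], (d.hole i).IsIPlusRegular ∧ (d.hole i).metric.toPseudoRiemannianMetric.IsRicciFlat ∧ (d.hole i).horizon.Nonempty ∧ (∀ p ∈ (d.hole i).horizon, ∃ (U : Set (d.hole i).carrier) (K : Π x : (d.hole i).carrier, TangentSpace (𝓡 4) x) (κ : ℝ), IsOpen U ∧ connectedComponentIn (d.hole i).horizon p ⊆ U ∧ ContMDiffOn (𝓡 4) ((𝓡 4).prod 𝓘(ℝ, Literature.Geometry.Lorentzian.E4)) ((⊤ : ℕ∞) : WithTop ℕ∞) (fun x ↦ (Bundle.TotalSpace.mk' Literature.Geometry.Lorentzian.E4 x (K x) : TangentBundle (𝓡 4) (d.hole i).carrier)) U ∧ (∀ x ∈ U, ∀ v w : TangentSpace (𝓡 4) x, (d.hole i).metric.val x ((d.hole i).metric.leviCivita K x v) w + (d.hole i).metric.val x v ((d.hole i).metric.leviCivita K x w) = 0) ∧ (∀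 x ∈ U, VectorField.mlieBracket (𝓡 4) (d.hole i).killing K x = 0) ∧ (∀ q ∈ connectedComponentIn (d.hole i).horizon p, K q ≠ 0) ∧ (∀ γ : ℝ → (d.hole i).carrier, IsMIntegralCurve γ K → γ 0 ∈ connectedComponentIn (d.hole i).horizon p → ∀ t, γ t ∈ (d.hole i).horizon) ∧ κ ≠ 0 ∧ ∀ q ∈ connectedComponentIn (d.hole i).horizon p, (d.hole i).metric.leviCivita K q (K q) = κ • K q))) → (∀ i, Summit.FinalStateConjecture.FinalStateConjecture.Theorems.SymplecticDualOfTheBomb.IsKerrCharted (d.hole i) (d.adapted i)) → (∀ i, (∀ x, Function.Injective (mfderiv 𝓘(ℝ, Literature.Geometry.Lorentzian.E4) (𝓡 4) (d.adapted i).toFun x)) ∧ (d.hole i).horizon ⊆ Set.range (d.adapted i).toFun) → (∃ R : Fin d.N → ℝ → ℝ, (∀ i, Filter.Tendsto (R i) Filter.atTop Filter.atTop) ∧ (∀ i, Filter.Tendsto (fun τ ↦ 𝓢.truncDeviationCk (d.background i) (d.toOver.chart i) 2 (R i τ) τ) Filter.atTop (nhds 0)) ∧ ∀ τ₁ : ℝ,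 d.toOver.τ₀ < τ₁ → O \ d.toOver.certifiedLate R τ₁ ⊆ 𝓢.metric.causalPast 𝓢.timeOrientation (d.toOver.certifiedSlab R τ₁)) → ((∀ i, Summit.FinalStateConjecture.IsOrthochronous (d.motion i).1) ∧ (∀ i (ρ : ℝ), ∀ᶠ τ in Filter.atTop, ∀ x ∈ (d.background i).truncTimeSlab ρ τ, ∀ v : Literature.Geometry.Lorentzian.E4, mfderiv 𝓘(ℝ, Literature.Geometry.Lorentzian.E4) (𝓡 4) (d.adapted i).toFun ⟨Literature.Geometry.Lorentzian.poincareInv (d.motion i).1 (d.motion i).2 x.1, x.2⟩ v = (d.hole i).timeOrientation.vectorField ((d.adapted i).toFun ⟨Literature.Geometry.Lorentzian.poincareInv (d.motion i).1 (d.motion i).2 x.1, x.2⟩) → 𝓢.timeOrientation.IsFutureDirected (mfderiv 𝓘(ℝ, Literature.Geometry.Lorentzian.E4) (𝓡 4) (d.toOver.chart i) x (((d.motion i).1 : Literature.Geometry.Lorentzian.E4 ≃L[ℝ] Literature.Geometry.Lorentzian.E4) v))) ∧ ∀ᶠ τ in Filter.atTop, ∀ x ∈ (Literature.Geometry.Lorentzian.Minkowski.backgroundOn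 d.toOver.flatDomain).timeSlab τ, 𝓢.timeOrientation.IsFutureDirected (mfderiv 𝓘(ℝ, Literature.Geometry.Lorentzian.E4) (𝓡 4) d.toOver.flatChart x (Literature.Geometry.Lorentzian.E4.basisVector 0))) → ∃ d' : Literature.Geometry.Lorentzian.FinalStateDecomposition 𝓢 O 2, (∀ i, Literature.Geometry.Lorentzian.Kerr.IsSubextremal (d'.mass i) (d'.spin i)) ∧ d'.charted = d.charted ∧ Summit.FinalStateConjecture.HasExhaustiveCharts d' ∧ Summit.FinalStateConjecture.IsFutureOriented d') →
      KerrChartTransfer := by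
  intro h₁ h₂ h₃
  rw [kerrChartTransfer_iff]
  intro 𝓢 O d hhole hK hnorm hexh hfut
  exact h₃ 𝓢 O d hhole (fun i ↦ isKerrCharted_of_stubs h₁ h₂ (d.hole i) (d.adapted i) (hhole i) (hK i) (hnorm i))
    hnorm hexh hfut

/-- The same, over the §0 statement names. -/
theorem kerrChartTransfer_of_stubs (h₁ : Sig.stub_futureEquivariantKerrIsometry)
    (h₂ : Sig.stub_collarHorizonExtension) (h₃ : Sig.stub_sameRegionTransfer) : KerrChartTransfer :=
  KerrChartTransfer_of h₁ h₂ h₃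

/-- The crux as currently inhabited through the three stubs (open only through their `sorry`s). -/
theorem kerrChartTransfer_via_birth : KerrChartTransfer :=
  KerrChartTransfer_of stub_futureEquivariantKerrIsometry stub_collarHorizonExtension stub_sameRegionTransfer

end Summit.FinalStateConjecture.FinalStateConjecture.Cruxes.KerrChartTransfer.Birth

end
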